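import Summits.FinalStateConjecture.FinalStateConjecture.Theorems.EIHFluxBalanceInertialRecessionStubFirstOrderVariation
import Summits.FinalStateConjecture.FinalStateConjecture.Theorems.EIHFluxBalanceInertialRecessionLorentz
import Literature.Geometry.Lorentzian.KerrWaveDecay
import Summits.FinalStateConjecture.FinalStateConjecture.Theorems.EIHFluxBalanceInertialRecessionStubSlaving3Coercive

/-!
# Route EIHFluxBalance — `InertialRecession` (E′), skeleton r13, stub `stub_firstOrderSlaving` (D),
# part 6: far-field size of the first-variation field of a painted summand

Helper file for the crux `stmt-FinalStateConjecture-17403` (E′), stub (D).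

* `firstOrder_norm_iteratedFDeriv_ksPert_le_pow` — **sharp decay of the Kerr–Schild perturbation**:
  `‖Dᵐ(g_{M,a} − η)(x)‖ ≤ C / ‖x~‖^{m+1}` for `r_a(x) ≥ max 1 (2|a|)` (the scaling proof of
  `Kerr.norm_iteratedFDeriv_ksPert_le`, keeping the full power);
* `firstOrder_far_lie` — hence the rest-frame first variation `∂_{Ay+d} g + g(A·,·) + g(·,A·)` of an
  `η`-skew rate `A` has size `O((‖A‖ + ‖d‖)/‖y~‖)` and derivative `O((‖A‖ + ‖d‖)/‖y~‖²)` far out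
  (the `η`-parts of the `A`-terms cancel, `firstOrder_norm_lie_le`);
* `firstOrder_far_variation` — **the lab first-variation field of a painted summand with bounded
  boost decays like `(‖A‖ + ‖d‖)/distance`, together with its first derivative**, at lab events on
  the slice through the centre.

Elementary; no definitions, no named facts.
-/

set_option linter.dupNamespace false
set_option maxSynthPendingDepth 3

noncomputable section

open scoped Topology
open Filter Set Function Literature.Geometry.Lorentzian
  Summit.FinalStateConjecture.FinalStateConjecture.Theorems

namespace Summit.FinalStateConjecture.FinalStateConjecture.Theorems.SublinearIsFree.Slaving

/-! ### Sharp decay of the Kerr–Schild perturbation -/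

-- the algebraic and the operator-norm instance paths on `E4 →L[ℝ] E4 →L[ℝ] ℝ` unify slowly
set_option synthInstance.maxHeartbeats 200000 in
/-- **Sharp decay of all derivatives of the Kerr–Schild perturbation**: for every order `m` there
is `C ≥ 0` with `‖Dᵐ (g_{M,a} − η)(x)‖ ≤ C / ‖x~‖^{m+1}` whenever `r_a(x) ≥ max 1 (2|a|)` (scaling:
`(g_{M,a} − η) = ε M (g_{1,εa} − η) ∘ (ε ·)` with `ε = 1/‖x~‖`, and the unit-shell bound
`Kerr.exists_bound_iteratedFDeriv_ksPert_one`; Kerr–Schild 1965, §§2–3). [cite: KerrSchild1965, §3] -/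
theorem firstOrder_norm_iteratedFDeriv_ksPert_le_pow (M a : ℝ) (m : ℕ) :
    ∃ C : ℝ, 0 ≤ C ∧ ∀ x : E4, max 1 (2 * |a|) ≤ Kerr.radius a x →
      ‖iteratedFDeriv ℝ m (fun y ↦ Kerr.bilin M a y - Minkowski.bilin) x‖ ≤
        C / E4.spatialNorm x ^ (m + 1) := by
  -- adapted from `Kerr.norm_iteratedFDeriv_ksPert_le` (KerrConvergenceProofs), keeping `ε^{m+1}`
  obtain ⟨B, hB⟩ := Kerr.exists_bound_iteratedFDeriv_ksPert_one m
  refine ⟨|M| * max B 0, by positivity, fun x hx ↦ ?_⟩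
  set s := E4.spatialNorm x with hs
  have hr1 : 1 ≤ Kerr.radius a x := (le_max_left _ _).trans hx
  have hr0 : 0 < Kerr.radius a x := one_pos.trans_le hr1
  have hrs : Kerr.radius a x ≤ s := Kerr.radius_le_spatialNorm a x
  have hs1 : 1 ≤ s := hr1.trans hrs
  have hs0 : 0 < s := one_pos.trans_le hs1
  have hsa : 2 * |a| ≤ s := (le_max_right _ _).trans (hx.trans hrs)
  set ε := s⁻¹ with hε
  have hε0 : 0 < ε := inv_pos.mpr hs0
  -- zero the time coordinate
  set x' : E4 := x - x 0 • E4.basisVector 0 with hx'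
  have hsp : E4.spatial x = E4.spatial x' := by
    have h0 : E4.spatial (E4.basisVector 0) = 0 := by
      ext i; simp
    rw [hx', map_sub, map_smul, h0, smul_zero, sub_zero]
  have hder := Kerr.iteratedFDeriv_ksPert_eq_of_spatial_eq M a m hsp
  have hrx' : Kerr.radius a x' = Kerr.radius a x := (Kerr.radius_eq_of_spatial_eq a hsp).symm
  have hsx' : E4.spatialNorm x' = s := by rw [hs, E4.spatialNorm, E4.spatialNorm, hsp]
  -- the rescaled point on the unit shell
  set y : E4 := ε • x' with hy
  have hy0 : y 0 = 0 := by simp [hy, hx']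
  have hy1 : E4.spatialNorm y = 1 := by
    rw [hy, Kerr.spatialNorm_smul, abs_of_pos hε0, hsx', hε, inv_mul_cancel₀ hs0.ne']
  have ha' : |ε * a| ≤ 1 / 2 := by
    rw [abs_mul, abs_of_pos hε0, hε, inv_mul_le_iff₀ hs0]
    linarith
  have hry : 0 < Kerr.radius (ε * a) y := by
    rw [hy, Kerr.radius_smul hε0, hrx']
    exact mul_pos hε0 hr0
  have hfun : (fun y ↦ Kerr.bilin M a y - Minkowski.bilin) =
      fun z ↦ (ε * M) • (Kerr.bilin 1 (ε * a) (ε • z) - Minkowski.bilin) :=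
    funext fun z ↦ Kerr.ksPert_smul hε0 M a z
  have hB0 : 0 ≤ max B 0 := le_max_right _ _
  have hkey := norm_iteratedFDeriv_const_smul_comp_smul_le
    (fun y ↦ Kerr.bilin 1 (ε * a) y - Minkowski.bilin) (ε * M) hε0.ne' x' (m := m)
    (Kerr.contDiffAt_ksPert (M := 1) hry)
  have hεpow : ε * |ε| ^ m = (s ^ (m + 1))⁻¹ := by
    rw [abs_of_pos hε0, hε, ← pow_succ', inv_pow]
  calc ‖iteratedFDeriv ℝ m (fun y ↦ Kerr.bilin M a y - Minkowski.bilin) x‖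
        = ‖iteratedFDeriv ℝ m (fun y ↦ Kerr.bilin M a y - Minkowski.bilin) x'‖ := by rw [hder]
    _ = ‖iteratedFDeriv ℝ m
          (fun z ↦ (ε * M) • (Kerr.bilin 1 (ε * a) (ε • z) - Minkowski.bilin)) x'‖ := by
        rw [← hfun]
    _ ≤ |ε * M| * |ε| ^ m *
          ‖iteratedFDeriv ℝ m (fun y ↦ Kerr.bilin 1 (ε * a) y - Minkowski.bilin) y‖ := hkey
    _ ≤ |ε * M| * |ε| ^ m * max B 0 := by
        gcongr
        exact (hB _ ha' y hy0 hy1).trans (le_max_left _ _)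
    _ = (ε * |ε| ^ m) * (|M| * max B 0) := by rw [abs_mul, abs_of_pos hε0]; ring
    _ = |M| * max B 0 / s ^ (m + 1) := by rw [hεpow, div_eq_inv_mul]

/-! ### Far-field size of the rest-frame first variation -/

-- the algebraic and the operator-norm instance paths on `E4 →L[ℝ] E4 →L[ℝ] ℝ` unify slowly
set_option synthInstance.maxHeartbeats 200000 in
set_option maxHeartbeats 800000 in
/-- **Far-field size of the rest-frame first variation and of its derivative.** There is `C ≥ 0`
(depending on `M, a`) such that for every `η`-skew `A`, every `d` and every `y` with
`r_a(y) ≥ max 1 (2|a|)`, with `t = 1/‖y~‖` and `Q = ‖A‖(1 + ‖y‖ t) + ‖d‖`: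
`‖∂_{Ay+d} g + g(A·,·) + g(·,A·)‖ ≤ C Q t` and the field has a derivative at `y` of norm `≤ C Q t²`.
[cite: KerrSchild1965, §3] -/
theorem firstOrder_far_lie (M a : ℝ) :
    ∃ C : ℝ, 0 ≤ C ∧ ∀ (A : E4 →L[ℝ] E4) (d y : E4),
      (∀ u w : E4, Minkowski.bilin (A u) w + Minkowski.bilin u (A w) = 0) →
      max 1 (2 * |a|) ≤ Kerr.radius a y →
      ‖fderiv ℝ (Kerr.bilin M a) y (A y + d) + (Kerr.bilin M a y).comp A +
          ((Kerr.bilin M a y).flip.comp A).flip‖ ≤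
        C * (‖A‖ * (1 + ‖y‖ * (E4.spatialNorm y)⁻¹) + ‖d‖) * (E4.spatialNorm y)⁻¹ ∧
      ∃ L' : E4 →L[ℝ] E4 →L[ℝ] E4 →L[ℝ] ℝ,
        HasFDerivAt (fun y' ↦ fderiv ℝ (Kerr.bilin M a) y' (A y' + d) + (Kerr.bilin M a y').comp A +
          ((Kerr.bilin M a y').flip.comp A).flip) L' y ∧
        ‖L'‖ ≤ C * (‖A‖ * (1 + ‖y‖ * (E4.spatialNorm y)⁻¹) + ‖d‖) * (E4.spatialNorm y)⁻¹ ^ 2 := by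
  obtain ⟨C₀, hC₀, h0⟩ := firstOrder_norm_iteratedFDeriv_ksPert_le_pow M a 0
  obtain ⟨C₁, hC₁, h1⟩ := firstOrder_norm_iteratedFDeriv_ksPert_le_pow M a 1
  obtain ⟨C₂, hC₂, h2⟩ := firstOrder_norm_iteratedFDeriv_ksPert_le_pow M a 2
  refine ⟨2 * C₀ + C₁ + C₂ + 3 * C₁, by positivity, fun A d y hA hy ↦ ?_⟩
  set K : E4 → E4 →L[ℝ] E4 →L[ℝ] ℝ := Kerr.bilin M a with hK
  set s : ℝ := E4.spatialNorm y with hs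
  have hr1 : 1 ≤ Kerr.radius a y := (le_max_left _ _).trans hy
  have hr0 : 0 < Kerr.radius a y := one_pos.trans_le hr1
  have hs1 : 1 ≤ s := hr1.trans (Kerr.radius_le_spatialNorm a y)
  have hs0 : 0 < s := one_pos.trans_le hs1
  set t : ℝ := s⁻¹ with ht
  have ht0 : 0 ≤ t := inv_nonneg.2 hs0.le
  have ht1 : t ≤ 1 := inv_le_one_of_one_le₀ hs1
  have hst : s * t = 1 := mul_inv_cancel₀ hs0.ne'
  -- the perturbation and its derivatives at `y`
  have hfd : fderiv ℝ K y = fderiv ℝ (fun y ↦ K y - Minkowski.bilin) y := (fderiv_sub_const _).symm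
  have hfd2 : fderiv ℝ (fderiv ℝ K) y = fderiv ℝ (fderiv ℝ (fun y ↦ K y - Minkowski.bilin)) y := by
    congr 1; funext z; exact (fderiv_sub_const _).symm
  obtain ⟨e1, e2⟩ := norm_fderiv_eq_norm_iteratedFDeriv (fun y ↦ K y - Minkowski.bilin) y
  have n0 : ‖K y - Minkowski.bilin‖ ≤ C₀ * t := by
    have := h0 y hy
    rwa [norm_iteratedFDeriv_zero, zero_add, pow_one, div_eq_mul_inv] at this
  have n1 : ‖fderiv ℝ K y‖ ≤ C₁ * t ^ 2 := by
    rw [hfd, e1, ht, inv_pow, ← div_eq_mul_inv]; exact h1 y hy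
  have n2 : ‖fderiv ℝ (fderiv ℝ K) y‖ ≤ C₂ * t ^ 3 := by
    rw [hfd2, e2, ht, inv_pow, ← div_eq_mul_inv]; exact h2 y hy
  have nA : 0 ≤ ‖A‖ := norm_nonneg _
  have nd : 0 ≤ ‖d‖ := norm_nonneg _
  have ny : 0 ≤ ‖y‖ := norm_nonneg _
  set Q : ℝ := ‖A‖ * (1 + ‖y‖ * t) + ‖d‖ with hQ
  have hQ0 : 0 ≤ Q := by positivity
  have hAQ : ‖A‖ ≤ Q := by rw [hQ]; nlinarith [mul_nonneg ny ht0]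
  -- `t (‖A‖ ‖y‖ + ‖d‖) ≤ Q`
  have hlin : t * (‖A‖ * ‖y‖ + ‖d‖) ≤ Q := by rw [hQ]; nlinarith [mul_nonneg nd ht0]
  have hKC : ContDiffAt ℝ 2 K y := Kerr.contDiffAt_bilin M a hr0
  have hP0 : 0 ≤ ‖A‖ * ‖y‖ + ‖d‖ := by positivity
  refine ⟨?_, ?_⟩
  · have hb := firstOrder_norm_lie_le (K := K) (y := y) (d := d) hA
    have h3 : ‖fderiv ℝ K y‖ * (‖A‖ * ‖y‖ + ‖d‖) ≤ C₁ * t * Q := by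
      calc _ ≤ C₁ * t ^ 2 * (‖A‖ * ‖y‖ + ‖d‖) := mul_le_mul_of_nonneg_right n1 hP0
        _ = C₁ * t * (t * (‖A‖ * ‖y‖ + ‖d‖)) := by ring
        _ ≤ C₁ * t * Q := mul_le_mul_of_nonneg_left hlin (by positivity)
    have h4 : 2 * ‖K y - Minkowski.bilin‖ * ‖A‖ ≤ 2 * (C₀ * t) * Q :=
      mul_le_mul (mul_le_mul_of_nonneg_left n0 zero_le_two) hAQ nA (by positivity)
    calc _ ≤ ‖fderiv ℝ K y‖ * (‖A‖ * ‖y‖ + ‖d‖) + 2 * ‖K y - Minkowski.bilin‖ * ‖A‖ := hb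
      _ ≤ C₁ * t * Q + 2 * (C₀ * t) * Q := add_le_add h3 h4
      _ ≤ (2 * C₀ + C₁ + C₂ + 3 * C₁) * Q * t := by nlinarith [mul_nonneg hQ0 ht0]
  · obtain ⟨L', hL', hnL'⟩ := firstOrder_hasFDerivAt_lie hKC A d
    refine ⟨L', hL', hnL'.trans ?_⟩
    have h3 : ‖fderiv ℝ (fderiv ℝ K) y‖ * (‖A‖ * ‖y‖ + ‖d‖) ≤ C₂ * t ^ 2 * Q := by
      calc _ ≤ C₂ * t ^ 3 * (‖A‖ * ‖y‖ + ‖d‖) := mul_le_mul_of_nonneg_right n2 hP0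
        _ = C₂ * t ^ 2 * (t * (‖A‖ * ‖y‖ + ‖d‖)) := by ring
        _ ≤ C₂ * t ^ 2 * Q := mul_le_mul_of_nonneg_left hlin (by positivity)
    have h4 : 3 * ‖fderiv ℝ K y‖ * ‖A‖ ≤ 3 * (C₁ * t ^ 2) * Q :=
      mul_le_mul (mul_le_mul_of_nonneg_left n1 (by norm_num)) hAQ nA (by positivity)
    calc _ ≤ C₂ * t ^ 2 * Q + 3 * (C₁ * t ^ 2) * Q := add_le_add h3 h4
      _ ≤ (2 * C₀ + C₁ + C₂ + 3 * C₁) * Q * t ^ 2 := by nlinarith [mul_nonneg hQ0 (sq_nonneg t)]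

/-! ### Far-field size of the lab first-variation field of a painted summand -/

-- the algebraic and the operator-norm instance paths on `E4 →L[ℝ] E4 →L[ℝ] ℝ` unify slowly
set_option synthInstance.maxHeartbeats 200000 in
set_option maxHeartbeats 800000 in
/-- **Far-field decay of the lab first-variation field.** There is `C ≥ 0` (depending on `M, a, γ`)
such that for every Lorentz `L` with `|(Le₀)⁰| ≤ γ`, every `η`-skew `A`, every `d`, every centre
`c` and every lab event `x` with `x − c` spatial and `‖x − c‖ ≥ max 1 (2|a|) + |a|`, the lab
first-variation field `V(z) = (∂_{Ay+d} g)(S·,S·) + g(AS·,S·) + g(S·,AS·)`, `y = L⁻¹(z − c)`,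
`S = L⁻¹`, satisfies `‖V(x)‖ + ‖DV(x)‖ ≤ C (‖A‖ + ‖d‖) / ‖x − c‖`. [cite: KerrSchild1965, §3] -/
theorem firstOrder_far_variation (M a γ : ℝ) :
    ∃ C : ℝ, 0 ≤ C ∧ ∀ (L : lorentzGroup) (A : E4 →L[ℝ] E4) (d c x : E4),
      |((L : E4 ≃L[ℝ] E4) (E4.basisVector 0)) 0| ≤ γ →
      (∀ u w : E4, Minkowski.bilin (A u) w + Minkowski.bilin u (A w) = 0) →
      (x - c) 0 = 0 → max 1 (2 * |a|) + |a| ≤ ‖x - c‖ →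
      ‖(fderiv ℝ (Kerr.bilin M a) (poincareInv L c x) (A (poincareInv L c x) + d)).bilinearComp
            (((L : E4 ≃L[ℝ] E4).symm : E4 →L[ℝ] E4)) (((L : E4 ≃L[ℝ] E4).symm : E4 →L[ℝ] E4)) +
          (Kerr.bilin M a (poincareInv L c x)).bilinearComp
            (A.comp (((L : E4 ≃L[ℝ] E4).symm : E4 →L[ℝ] E4))) (((L : E4 ≃L[ℝ] E4).symm : E4 →L[ℝ] E4)) +
          (Kerr.bilin M a (poincareInv L c x)).bilinearComp
            (((L : E4 ≃L[ℝ] E4).symm : E4 →L[ℝ] E4)) (A.comp (((L : E4 ≃L[ℝ] E4).symm : E4 →L[ℝ] E4)))‖ +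
        ‖fderiv ℝ (fun z ↦
          (fderiv ℝ (Kerr.bilin M a) (poincareInv L c z) (A (poincareInv L c z) + d)).bilinearComp
            (((L : E4 ≃L[ℝ] E4).symm : E4 →L[ℝ] E4)) (((L : E4 ≃L[ℝ] E4).symm : E4 →L[ℝ] E4)) +
          (Kerr.bilin M a (poincareInv L c z)).bilinearComp
            (A.comp (((L : E4 ≃L[ℝ] E4).symm : E4 →L[ℝ] E4))) (((L : E4 ≃L[ℝ] E4).symm : E4 →L[ℝ] E4)) +
          (Kerr.bilin M a (poincareInv L c z)).bilinearComp
            (((L : E4 ≃L[ℝ] E4).symm : E4 →L[ℝ] E4)) (A.comp (((L : E4 ≃L[ℝ] E4).symm : E4 →L[ℝ] E4))))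
          x‖ ≤ C * (‖A‖ + ‖d‖) / ‖x - c‖ := by
  obtain ⟨C, hC, hfar⟩ := firstOrder_far_lie M a
  set Γ : ℝ := 1 + 3 * |γ| with hΓ
  have hΓ1 : 1 ≤ Γ := by rw [hΓ]; linarith [abs_nonneg γ]
  refine ⟨C * (2 + Γ) * Γ ^ 3 * 2, by positivity, fun L A d c x hL hA hxc hfarx ↦ ?_⟩
  set S : E4 →L[ℝ] E4 := (((L : E4 ≃L[ℝ] E4).symm : E4 →L[ℝ] E4)) with hS
  set K : E4 → E4 →L[ℝ] E4 →L[ℝ] ℝ := Kerr.bilin M a with hK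
  set w : E4 := x - c with hw
  set y : E4 := S w with hy
  have hyP : ∀ z, poincareInv L c z = S (z - c) := fun z ↦ rfl
  -- geometry of the far point
  have hm1 : 1 ≤ max 1 (2 * |a|) := le_max_left _ _
  have hw1 : 1 ≤ ‖w‖ := by linarith [abs_nonneg a]
  have hw0 : 0 < ‖w‖ := one_pos.trans_le hw1
  have hSn : ‖S‖ ≤ Γ := by
    refine (norm_lorentz_symm_le' L).trans ?_
    rw [hΓ]; linarith [hL.trans (le_abs_self γ)]
  have hsN : ‖w‖ ≤ E4.spatialNorm y := by
    have h := norm_le_spatialNorm_lorentz_apply L⁻¹ hxc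
    rwa [coe_lorentz_inv] at h
  have hs0 : 0 < E4.spatialNorm y := hw0.trans_le hsN
  have hny : ‖y‖ ≤ Γ * ‖w‖ := (S.le_opNorm w).trans (mul_le_mul_of_nonneg_right hSn (norm_nonneg _))
  have hrad : max 1 (2 * |a|) ≤ Kerr.radius a y := by
    have h1 := Kerr.spatialNorm_sq_sub_sq_le_radius_sq a y
    have hm0 : 0 ≤ max 1 (2 * |a|) := zero_le_one.trans hm1
    have h3 : (max 1 (2 * |a|) + |a|) ^ 2 ≤ E4.spatialNorm y ^ 2 :=
      pow_le_pow_left₀ (by positivity) (hfarx.trans hsN) 2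
    have h2 : max 1 (2 * |a|) ^ 2 ≤ Kerr.radius a y ^ 2 := by
      have e : |a| ^ 2 = a ^ 2 := sq_abs a
      nlinarith [h1, h3, mul_nonneg hm0 (abs_nonneg a), e]
    exact (pow_le_pow_iff_left₀ hm0 (Kerr.radius_nonneg a y) two_ne_zero).1 h2
  obtain ⟨hval, L', hL', hnL'⟩ := hfar A d y hA hrad
  -- inverse lengths
  set t : ℝ := (E4.spatialNorm y)⁻¹ with ht
  set τ : ℝ := ‖w‖⁻¹ with hτ
  have ht0 : 0 ≤ t := inv_nonneg.2 hs0.le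
  have htτ : t ≤ τ := (inv_le_inv₀ hs0 hw0).2 hsN
  have hτ1 : τ ≤ 1 := inv_le_one_of_one_le₀ hw1
  have ht1 : t ≤ 1 := htτ.trans hτ1
  have htt : t ^ 2 ≤ τ := by nlinarith
  -- the reduced size factor
  set Q : ℝ := ‖A‖ * (1 + ‖y‖ * t) + ‖d‖ with hQ
  have nA : 0 ≤ ‖A‖ := norm_nonneg _
  have nd : 0 ≤ ‖d‖ := norm_nonneg _
  have hQ0 : 0 ≤ Q := by positivity
  have hyt : ‖y‖ * t ≤ Γ := by
    calc ‖y‖ * t ≤ Γ * ‖w‖ * t := mul_le_mul_of_nonneg_right hny ht0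
      _ ≤ Γ * ‖w‖ * τ := mul_le_mul_of_nonneg_left htτ (by positivity)
      _ = Γ := by rw [hτ, mul_assoc, mul_inv_cancel₀ hw0.ne', mul_one]
  have hQle : Q ≤ (2 + Γ) * (‖A‖ + ‖d‖) := by rw [hQ]; nlinarith [mul_nonneg nA (sub_nonneg.2 hyt)]
  -- the lab field is the pull-back of the rest-frame field
  have hfun : (fun z ↦ (fderiv ℝ K (poincareInv L c z) (A (poincareInv L c z) + d)).bilinearComp S S +
      (K (poincareInv L c z)).bilinearComp (A.comp S) S +
      (K (poincareInv L c z)).bilinearComp S (A.comp S)) = fun z ↦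
      (fderiv ℝ K (S (z - c)) (A (S (z - c)) + d) + (K (S (z - c))).comp A +
        ((K (S (z - c))).flip.comp A).flip).bilinearComp S S := by
    funext z
    rw [firstOrder_lie_bilinearComp_eq, hyP]
  obtain ⟨V', hV', -, hnV'⟩ := firstOrder_hasFDerivAt_pullback (F := fun y' ↦
    fderiv ℝ K y' (A y' + d) + (K y').comp A + ((K y').flip.comp A).flip) S c x hL'
  rw [hfun, hV'.fderiv]
  have hS3 : ‖S‖ ^ 3 ≤ Γ ^ 3 := pow_le_pow_left₀ (norm_nonneg _) hSn 3
  have hΓ0 : 0 ≤ Γ := zero_le_one.trans hΓ1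
  have hS2 : ‖S‖ * ‖S‖ ≤ Γ ^ 3 := by
    have hSS : ‖S‖ * ‖S‖ ≤ Γ * Γ := mul_le_mul hSn hSn (norm_nonneg _) hΓ0
    have hGG : Γ * Γ * 1 ≤ Γ * Γ * Γ := mul_le_mul_of_nonneg_left hΓ1 (mul_nonneg hΓ0 hΓ0)
    calc ‖S‖ * ‖S‖ ≤ Γ * Γ * 1 := by rw [mul_one]; exact hSS
      _ ≤ Γ * Γ * Γ := hGG
      _ = Γ ^ 3 := by ring
  have hval' : ‖(fderiv ℝ K (S (x - c)) (A (S (x - c)) + d) + (K (S (x - c))).comp A +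
      ((K (S (x - c))).flip.comp A).flip).bilinearComp S S‖ ≤ C * Q * t * Γ ^ 3 := by
    refine (firstOrder_norm_bilinearComp_le _ _ _).trans ?_
    rw [mul_assoc]
    exact mul_le_mul hval hS2 (by positivity) (by positivity)
  have hder' : ‖V'‖ ≤ C * Q * t ^ 2 * Γ ^ 3 :=
    hnV'.trans (mul_le_mul hnL' hS3 (by positivity) (by positivity))
  have hCQ : 0 ≤ C * Q := by positivity
  calc _ ≤ C * Q * t * Γ ^ 3 + C * Q * t ^ 2 * Γ ^ 3 := add_le_add hval' hder'
    _ ≤ C * Q * τ * Γ ^ 3 + C * Q * τ * Γ ^ 3 := by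
        have h1 : C * Q * t * Γ ^ 3 ≤ C * Q * τ * Γ ^ 3 := by
          have := mul_le_mul_of_nonneg_left htτ hCQ; nlinarith [pow_nonneg (zero_le_one.trans hΓ1) 3]
        have h2 : C * Q * t ^ 2 * Γ ^ 3 ≤ C * Q * τ * Γ ^ 3 := by
          have := mul_le_mul_of_nonneg_left htt hCQ; nlinarith [pow_nonneg (zero_le_one.trans hΓ1) 3]
        exact add_le_add h1 h2
    _ = C * Q * Γ ^ 3 * 2 * τ := by ring
    _ ≤ C * ((2 + Γ) * (‖A‖ + ‖d‖)) * Γ ^ 3 * 2 * τ := by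
        have hτ0 : 0 ≤ τ := inv_nonneg.2 hw0.le
        have h := mul_le_mul_of_nonneg_left hQle hC
        calc C * Q * Γ ^ 3 * 2 * τ = (C * Q) * (Γ ^ 3 * 2 * τ) := by ring
          _ ≤ (C * ((2 + Γ) * (‖A‖ + ‖d‖))) * (Γ ^ 3 * 2 * τ) :=
              mul_le_mul_of_nonneg_right h (by positivity)
          _ = _ := by ring
    _ = C * (2 + Γ) * Γ ^ 3 * 2 * (‖A‖ + ‖d‖) / ‖w‖ := by rw [hτ, div_eq_mul_inv]; ring

/-- **Registered one-line carrier form** (`firstOrder_ksPert_decay_D6`, stub (D) of the crux item)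
of `firstOrder_norm_iteratedFDeriv_ksPert_le_pow`. [cite: KerrSchild1965, §3] -/
theorem firstOrder_ksPert_decay_D6 : open Literature.Geometry.Lorentzian in ∀ (M a : ℝ) (m : ℕ), ∃ C : ℝ, 0 ≤ C ∧ ∀ x : E4, max 1 (2 * |a|) ≤ Kerr.radius a x → ‖iteratedFDeriv ℝ m (fun y ↦ Kerr.bilin M a y - Minkowski.bilin) x‖ ≤ C / E4.spatialNorm x ^ (m + 1) :=
  firstOrder_norm_iteratedFDeriv_ksPert_le_pow

end Summit.FinalStateConjecture.FinalStateConjecture.Theorems.SublinearIsFree.Slaving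

end
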